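import Mathlib.Analysis.SpecialFunctions.ImproperIntegrals
import Mathlib.Analysis.SpecialFunctions.Integrability.Basic
import Mathlib.MeasureTheory.Integral.Prod
import Literature.Analysis.Distribution.SchwartzParameterIntegral
import HarnessLib

/-!
# A real positive-definite function pairs nonnegatively with Fejér triangles and with `|s|^{-δ}`

Analysis/Fourier support file (everything proved; no definitions, no named facts).

Let `g : ℝ → ℝ` be continuous and **positive-definite with real coefficients**:
`∑ⱼ ∑ₗ wⱼ wₗ g(sⱼ - sₗ) ≥ 0` for all finite real configurations `(sⱼ)` and real weights `(wⱼ)`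
(the hypothesis is spelled out, not packaged as a definition; it is implied by, and strictly
weaker than, complex positive-definiteness `Literature.Analysis.FunctionSpaces.IsPositiveDefinite`
of `s ↦ (g s : ℂ)` — with real weights any odd function may be added to `g`). Then

* `integral_mul_posPart_sub_abs_nonneg`: `∫ g(s) (t - |s|)₊ ds ≥ 0` for every `t > 0`
  (the Fejér triangle `(t - |s|)₊ = (𝟙_{[0,t]} ⋆ 𝟙_{[-t,0]})(s)` is the pairing of the smeared
  configuration "Lebesgue measure on `[0, t]`" with itself);
* `integral_mul_abs_rpow_neg_nonneg`: `∫ g(s) |s|^{-δ} ds ≥ 0` for `δ > 0` whenever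
  `g(s)|s|^{-δ}` is integrable (the Riesz weight is a positive mixture of triangles,
  `|s|^{-δ} = δ(δ+1) ∫₀^∞ (t - |s|)₊ t^{-(δ+2)} dt`, `integral_Ioi_posPart_sub_mul_rpow` — Pólya's
  representation of an even function that is convex and decreasing to `0` on `(0, ∞)`).

Both are the `ĝ ≥ 0` half of Bochner's theorem tested against weights with nonnegative Fourier
transform (`𝓕(t - |s|)₊ = t² sinc²`, `𝓕|s|^{-δ} = c_δ |ξ|^{δ-1}` for `0 < δ < 1`), proved here
by bare hands, without Fourier analysis and without boundedness or integrability of `g` itself: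

1. `tendsto_riemannSum_intervalIntegral_atTop` — left Riemann sums with `N → ∞` equal steps of a
   continuous Banach-valued function converge to the interval integral (from the quantitative
   bound `Literature.Analysis.Distribution.norm_riemannSum_sub_intervalIntegral_le`);
2. `sum_range_sum_range_apply_sub` — Fejér's counting identity
   `∑_{j,l<N} φ(j - l) = ∑_{|k|<N} (N - |k|) φ(k)`;
3. the Riemann sums of `s ↦ g(s)(t - |s|)₊` on `[-t, t]` with `2N` steps are `(t/N)²` times the
   positive-definite double sums `∑_{j,l<N} g((j - l) t/N) ≥ 0`, whence the first pairing;
4. the mixture identity by `integral_Ioi_rpow_of_lt`, and the second pairing by Fubini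
   (`MeasureTheory.integral_integral_swap`) over `ℝ × (0, ∞)`.

Used by the `CriticalPhenomena/Ising3DConformalLimit` route `PrecisionLaplacian` (reflection
positivity of axially probed X-rays of a reflection-positive kernel: for a mirror-RP kernel `K`
and a configuration `(p_a, c_a)` the function `s ↦ ∑ c_a c_b K(p_a - θ p_b + s e)`, `e` in the
mirror, is real positive-definite but in general not even).

## References (all statements are classical; tagged folklore)

* S. Bochner, *Vorlesungen über Fouriersche Integrale* (1932), §20; *Math. Ann.* 108 (1933) §2 —
  passage from discrete to integrated positive definiteness (cf. the complex, finite-measure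
  version `Literature.Analysis.FunctionSpaces.IsPositiveDefinite.re_integral_integral_nonneg`).
* G. Pólya, *Remarks on characteristic functions*, Proc. Berkeley Symp. (1949), Thm. 1 — convex
  functions as mixtures of triangles.

## Mathlib

Mathlib (this pin) has no positive-definite functions on groups and no Riemann-sum convergence
theorem for continuous functions outside the `BoxIntegral` library (searched: `PositiveDefinite`,
`riemannSum`, `Riemann sum`); it has everything used here (`integral_Ioi_rpow_of_lt`,
`integrableOn_Ioi_rpow_of_lt`, `integrable_prod_iff`, `integral_integral_swap`).
-/

noncomputable section

open _root_.MeasureTheory Set Filter Finset intervalIntegral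
open scoped _root_.Topology BigOperators

namespace Literature.Analysis.Fourier

/-! ### Riemann sums with an arbitrary number of steps -/

/-- **Left-endpoint Riemann sums of a continuous function converge to the integral** as the
number `N` of equal steps tends to infinity (the `2ⁿ`-step version is
`Literature.Analysis.Distribution.tendsto_riemannSum_intervalIntegral`). [folklore] -/
theorem tendsto_riemannSum_intervalIntegral_atTop {G : Type*} [NormedAddCommGroup G]
    [NormedSpace ℝ G] [CompleteSpace G] {g : ℝ → G} (hg : Continuous g) {a b : ℝ} (hab : a ≤ b) :
    Tendsto (fun N : ℕ => ∑ i ∈ range N, ((b - a) / N) • g (a + i * ((b - a) / N)))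
      atTop (𝓝 (∫ t in a..b, g t)) := by
  refine Metric.tendsto_atTop.2 fun ε hε => ?_
  obtain ⟨δ, hδ, hU⟩ := Metric.uniformContinuousOn_iff.1
    (isCompact_Icc.uniformContinuousOn_of_continuous hg.continuousOn) (ε / (b - a + 1))
    (by positivity)
  obtain ⟨N₀, hN₀⟩ := exists_nat_gt ((b - a) / δ)
  refine ⟨N₀ + 1, fun N hN => ?_⟩
  have hN1 : (N₀ : ℝ) + 1 ≤ N := by exact_mod_cast hN
  have hNpos : (0 : ℝ) < N := by linarith [N₀.cast_nonneg (α := ℝ)]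
  have hNδ : (b - a) / N < δ := by
    rw [div_lt_iff₀ hNpos]
    rw [div_lt_iff₀ hδ] at hN₀
    nlinarith
  rw [dist_eq_norm]
  have h := Literature.Analysis.Distribution.norm_riemannSum_sub_intervalIntegral_le hg hab
    (N := N) (by exact_mod_cast hNpos) (ω := ε / (b - a + 1)) fun t ht t' ht' htt' => ?_
  · refine h.trans_lt ?_
    rw [mul_div_assoc', div_lt_iff₀ (by linarith)]
    nlinarith
  · have hd := hU t ht t' ht' (by rw [Real.dist_eq]; exact lt_of_le_of_lt htt' hNδ)
    rw [dist_eq_norm] at hd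
    exact hd.le

/-! ### The Fejér counting identity -/

/-- Reindexing `∑_{l<N} φ(N - l) = ∑_{i<N} φ(i + 1)`. [folklore] -/
theorem sum_range_apply_sub_eq (φ : ℝ → ℝ) (N : ℕ) :
    ∑ l ∈ range N, φ ((N : ℝ) - l) = ∑ i ∈ range N, φ ((i : ℝ) + 1) := by
  induction N with
  | zero => simp
  | succ N ih =>
    rw [Finset.sum_range_succ' (fun l : ℕ => φ (((N + 1 : ℕ) : ℝ) - l)), Finset.sum_range_succ]
    push_cast
    simp only [add_sub_add_right_eq_sub, sub_zero, ih]

/-- **Fejér's counting identity** `∑_{j,l<N} φ(j - l) = ∑_{|k|<N} (N - |k|) φ(k)`, written with the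
two halves `k = i - N < 0` (weight `i`) and `k = i ≥ 0` (weight `N - i`). [folklore] -/
theorem sum_range_sum_range_apply_sub (φ : ℝ → ℝ) (N : ℕ) :
    ∑ j ∈ range N, ∑ l ∈ range N, φ ((j : ℝ) - l) =
      ∑ i ∈ range N, (i : ℝ) * φ ((i : ℝ) - N) + ∑ i ∈ range N, ((N : ℝ) - i) * φ i := by
  induction N with
  | zero => simp
  | succ N ih =>
    rw [Finset.sum_range_succ' (fun i : ℕ => (i : ℝ) * φ ((i : ℝ) - ((N + 1 : ℕ) : ℝ))),
      Finset.sum_range_succ (fun i : ℕ => (((N + 1 : ℕ) : ℝ) - i) * φ i)]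
    simp only [Finset.sum_range_succ, Finset.sum_add_distrib]
    rw [ih, sum_range_apply_sub_eq φ N]
    have e1 : ∑ i ∈ range N, (((i + 1 : ℕ) : ℝ)) * φ (((i + 1 : ℕ) : ℝ) - ((N + 1 : ℕ) : ℝ)) =
        ∑ i ∈ range N, (i : ℝ) * φ ((i : ℝ) - N) + ∑ i ∈ range N, φ ((i : ℝ) - N) := by
      rw [← Finset.sum_add_distrib]
      refine Finset.sum_congr rfl fun i _ => ?_
      push_cast
      rw [add_sub_add_right_eq_sub]
      ring
    have e2 : ∑ i ∈ range N, (((N + 1 : ℕ) : ℝ) - i) * φ i =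
        ∑ i ∈ range N, ((N : ℝ) - i) * φ i + ∑ i ∈ range N, φ i := by
      rw [← Finset.sum_add_distrib]
      refine Finset.sum_congr rfl fun i _ => ?_
      push_cast
      ring
    have e3 : ∑ i ∈ range N, φ ((i : ℝ) + 1) + φ 0 = ∑ i ∈ range N, φ i + φ N := by
      have h1 := Finset.sum_range_succ' (fun i : ℕ => φ i) N
      have h2 := Finset.sum_range_succ (fun i : ℕ => φ i) N
      push_cast at h1 h2
      linarith
    rw [e1, e2]
    push_cast
    simp only [sub_self, zero_sub, zero_mul, add_zero, add_sub_cancel_left, one_mul]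
    linarith [e3]

/-! ### Pairing with the Fejér triangle `(t - |s|)₊` -/

/-- **A continuous positive-definite function pairs nonnegatively with the Fejér triangle**:
if `g : ℝ → ℝ` is continuous and `∑ⱼₗ wⱼ wₗ g(sⱼ - sₗ) ≥ 0` for all finite real configurations,
then `∫ g(s) (t - |s|)₊ ds ≥ 0` for every `t > 0` (`= ∫₀ᵗ∫₀ᵗ g(r' - r) dr dr'`; proof: the
left Riemann sums of `s ↦ g(s)(t - |s|)₊` on `[-t, t]` with `2N` steps are `(t/N)²` times the
positive-definite double sums `∑_{j,l<N} g((j - l)t/N)`). [folklore] -/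
theorem integral_mul_posPart_sub_abs_nonneg {g : ℝ → ℝ} (hg : Continuous g)
    (hpd : ∀ (N : ℕ) (s w : Fin N → ℝ), 0 ≤ ∑ j, ∑ l, w j * w l * g (s j - s l))
    {t : ℝ} (ht : 0 < t) :
    0 ≤ ∫ s, g s * max (t - |s|) 0 := by
  set F : ℝ → ℝ := fun s => g s * max (t - |s|) 0 with hF
  have hFc : Continuous F := hg.mul ((continuous_const.sub continuous_abs).max continuous_const)
  -- the integral over `ℝ` is the integral over `[-t, t]`
  have hint : ∫ s, F s = ∫ s in (-t)..t, F s := by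
    rw [intervalIntegral.integral_of_le (by linarith), ← integral_Icc_eq_integral_Ioc,
      setIntegral_eq_integral_of_forall_compl_eq_zero]
    intro s hs
    simp only [Set.mem_Icc, not_and_or, not_le] at hs
    have : max (t - |s|) 0 = 0 := max_eq_right (by
      rcases hs with hs | hs
      · linarith [neg_abs_le s]
      · linarith [le_abs_self s])
    simp [hF, this]
  -- Riemann sums with `2N` steps
  have hR := (tendsto_riemannSum_intervalIntegral_atTop hFc (show -t ≤ t by linarith)).comp
    (tendsto_atTop_mono (fun N : ℕ => show N ≤ 2 * N by omega) tendsto_id)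
  rw [hint]
  refine ge_of_tendsto' hR fun N => ?_
  simp only [Function.comp_apply, smul_eq_mul]
  rcases Nat.eq_zero_or_pos N with rfl | hN
  · simp
  set η : ℝ := t / N with hη
  have hNpos : (0 : ℝ) < N := by exact_mod_cast hN
  have hη0 : 0 < η := div_pos ht hNpos
  have htN : t = N * η := by rw [hη]; field_simp
  have hstep : (t - -t) / ((2 * N : ℕ) : ℝ) = η := by
    rw [hη]; push_cast; field_simp; ring
  rw [hstep, two_mul, Finset.sum_range_add]
  -- first half: `s = (i - N) η ≤ 0`, `(t - |s|)₊ = i η`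
  have h1 : ∀ i ∈ range N, η * F (-t + i * η) = η * η * ((i : ℝ) * g (((i : ℝ) - N) * η)) := by
    intro i hi
    have hi' : (i : ℝ) < N := by exact_mod_cast Finset.mem_range.1 hi
    have hs : -t + i * η = ((i : ℝ) - N) * η := by rw [htN]; ring
    have habs : |((i : ℝ) - N) * η| = ((N : ℝ) - i) * η := by
      rw [abs_of_nonpos (mul_nonpos_of_nonpos_of_nonneg (by linarith) hη0.le)]; ring
    have hmax : max (t - |((i : ℝ) - N) * η|) 0 = i * η := by
      rw [habs, htN, max_eq_left] <;> nlinarith [(i.cast_nonneg : (0 : ℝ) ≤ i)]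
    simp only [hF, hs, hmax]
    ring
  -- second half: `s = i η ≥ 0`, `(t - |s|)₊ = (N - i) η`
  have h2 : ∀ i ∈ range N, η * F (-t + ((N + i : ℕ) : ℝ) * η) =
      η * η * (((N : ℝ) - i) * g ((i : ℝ) * η)) := by
    intro i hi
    have hi' : (i : ℝ) < N := by exact_mod_cast Finset.mem_range.1 hi
    have hs : -t + ((N + i : ℕ) : ℝ) * η = (i : ℝ) * η := by rw [htN]; push_cast; ring
    have habs : |(i : ℝ) * η| = (i : ℝ) * η := abs_of_nonneg (by positivity)
    have hmax : max (t - |(i : ℝ) * η|) 0 = ((N : ℝ) - i) * η := by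
      rw [habs, htN, max_eq_left] <;> nlinarith
    simp only [hF] at *
    rw [hs, hmax]
    ring
  rw [Finset.sum_congr rfl h1, Finset.sum_congr rfl h2, ← Finset.mul_sum, ← Finset.mul_sum,
    ← mul_add]
  refine mul_nonneg (mul_nonneg hη0.le hη0.le) ?_
  -- the bracket is the positive-definite double sum
  have key := sum_range_sum_range_apply_sub (fun x => g (x * η)) N
  have hsum : ∑ j ∈ range N, ∑ l ∈ range N, g (((j : ℝ) - l) * η) =
      ∑ j : Fin N, ∑ l : Fin N, (1 : ℝ) * 1 * g ((j : ℝ) * η - (l : ℝ) * η) := by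
    simp only [one_mul, Finset.sum_range, sub_mul]
  have h0 := hpd N (fun j => (j : ℝ) * η) (fun _ => 1)
  rw [← hsum, key] at h0
  exact h0

/-! ### The Riesz weight `|s|^{-δ}` as a mixture of Fejér triangles -/

/-- On `t > |s|` the weight `(t - |s|)₊ t^{-(δ+2)}` is `t^{-(δ+1)} - |s| t^{-(δ+2)}`. [folklore] -/
theorem eqOn_posPart_sub_mul_rpow (s δ : ℝ) :
    EqOn (fun t : ℝ => max (t - |s|) 0 * t ^ (-(δ + 2)))
      (fun t : ℝ => t ^ (-(δ + 1)) - |s| * t ^ (-(δ + 2))) (Ioi |s|) := by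
  intro t ht
  have ht0 : 0 < t := (abs_nonneg s).trans_lt ht
  simp only
  rw [max_eq_left (by linarith [le_of_lt (α := ℝ) ht]), sub_mul,
    show (-(δ + 1) : ℝ) = 1 + -(δ + 2) by ring, Real.rpow_add ht0, Real.rpow_one]

/-- The weight `t ↦ (t - |s|)₊ t^{-(δ+2)}` is integrable on `(0, ∞)` for `s ≠ 0`, `δ > 0`.
[folklore] -/
theorem integrableOn_posPart_sub_mul_rpow {s δ : ℝ} (hs : s ≠ 0) (hδ : 0 < δ) :
    IntegrableOn (fun t : ℝ => max (t - |s|) 0 * t ^ (-(δ + 2))) (Ioi 0) := by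
  have hs' : 0 < |s| := abs_pos.2 hs
  rw [← Ioc_union_Ioi_eq_Ioi hs'.le, integrableOn_union]
  constructor
  · refine integrableOn_zero.congr_fun (fun t ht => ?_) measurableSet_Ioc
    simp only
    rw [max_eq_right (by linarith [ht.2]), zero_mul]
  · have h1 : IntegrableOn (fun t : ℝ => t ^ (-(δ + 1))) (Ioi |s|) :=
      integrableOn_Ioi_rpow_of_lt (by linarith) hs'
    have h2 : IntegrableOn (fun t : ℝ => |s| * t ^ (-(δ + 2))) (Ioi |s|) :=
      (integrableOn_Ioi_rpow_of_lt (by linarith) hs').const_mul _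
    exact (h1.sub h2).congr_fun (eqOn_posPart_sub_mul_rpow s δ).symm measurableSet_Ioi

/-- **The Riesz weight is a mixture of Fejér triangles**:
`∫₀^∞ (t - |s|)₊ t^{-(δ+2)} dt = |s|^{-δ} / (δ(δ+1))` for `s ≠ 0`, `δ > 0` (Pólya's representation
of the convex decreasing function `|s|^{-δ}`). [folklore] -/
theorem integral_Ioi_posPart_sub_mul_rpow {s δ : ℝ} (hs : s ≠ 0) (hδ : 0 < δ) :
    ∫ t in Ioi (0:ℝ), max (t - |s|) 0 * t ^ (-(δ + 2)) = |s| ^ (-δ) / (δ * (δ + 1)) := by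
  have hs' : 0 < |s| := abs_pos.2 hs
  rw [setIntegral_eq_of_subset_of_forall_sdiff_eq_zero measurableSet_Ioi (Ioi_subset_Ioi hs'.le)
    (s := Ioi |s|) fun t ht => ?_]
  swap
  · have ht2 : t ≤ |s| := not_lt.1 fun h => ht.2 (Set.mem_Ioi.2 h)
    rw [max_eq_right (by linarith), zero_mul]
  have h1 : IntegrableOn (fun t : ℝ => t ^ (-(δ + 1))) (Ioi |s|) :=
    integrableOn_Ioi_rpow_of_lt (by linarith) hs'
  have h2 : IntegrableOn (fun t : ℝ => t ^ (-(δ + 2))) (Ioi |s|) :=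
    integrableOn_Ioi_rpow_of_lt (by linarith) hs'
  rw [setIntegral_congr_fun measurableSet_Ioi (eqOn_posPart_sub_mul_rpow s δ),
    integral_sub h1 (h2.const_mul _), MeasureTheory.integral_const_mul, integral_Ioi_rpow_of_lt (by linarith) hs',
    integral_Ioi_rpow_of_lt (by linarith) hs', show -(δ + 1) + 1 = -δ by ring,
    show -(δ + 2) + 1 = -(δ + 1) by ring]
  have hpow : |s| * |s| ^ (-(δ + 1)) = |s| ^ (-δ) := by
    rw [show -δ = 1 + -(δ + 1) by ring, Real.rpow_add hs', Real.rpow_one]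
  have hδ1 : (δ + 1) ≠ 0 := by positivity
  calc -|s| ^ (-δ) / -δ - |s| * (-|s| ^ (-(δ + 1)) / -(δ + 1))
      = |s| ^ (-δ) / δ - |s| * |s| ^ (-(δ + 1)) / (δ + 1) := by
        rw [neg_div_neg_eq, neg_div_neg_eq, mul_div_assoc]
    _ = |s| ^ (-δ) / δ - |s| ^ (-δ) / (δ + 1) := by rw [hpow]
    _ = |s| ^ (-δ) / (δ * (δ + 1)) := by field_simp; ring

/-! ### Pairing with the Riesz weight -/

/-- **A continuous positive-definite function pairs nonnegatively with the Riesz weight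
`|s|^{-δ}`**: if `g : ℝ → ℝ` is continuous, `∑ⱼₗ wⱼ wₗ g(sⱼ - sₗ) ≥ 0` for all finite real
configurations, `δ > 0` and `g(s)|s|^{-δ}` is integrable, then `∫ g(s) |s|^{-δ} ds ≥ 0`. Proof:
`|s|^{-δ} = δ(δ+1) ∫₀^∞ (t - |s|)₊ t^{-(δ+2)} dt` (`integral_Ioi_posPart_sub_mul_rpow`), Fubini,
and `∫ g(s)(t - |s|)₊ ds ≥ 0` (`integral_mul_posPart_sub_abs_nonneg`). (Consistent with
Bochner–Plancherel: `ĝ ≥ 0` and the Fourier transform of `|s|^{-δ}`, `0 < δ < 1`, is a positive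
multiple of `|ξ|^{δ-1}`.) [folklore] -/
theorem integral_mul_abs_rpow_neg_nonneg {g : ℝ → ℝ} (hg : Continuous g)
    (hpd : ∀ (N : ℕ) (s w : Fin N → ℝ), 0 ≤ ∑ j, ∑ l, w j * w l * g (s j - s l))
    {δ : ℝ} (hδ : 0 < δ) (hint : Integrable (fun s => g s * |s| ^ (-δ))) :
    0 ≤ ∫ s, g s * |s| ^ (-δ) := by
  set C : ℝ := δ * (δ + 1) with hC
  have hC0 : 0 < C := by positivity
  set k : ℝ → ℝ → ℝ := fun s t => max (t - |s|) 0 * t ^ (-(δ + 2)) with hk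
  have hk0 : ∀ s t, 0 < t → 0 ≤ k s t := fun s t ht =>
    mul_nonneg (le_max_right _ _) (Real.rpow_nonneg ht.le _)
  have hkint : ∀ s, s ≠ 0 → ∫ t in Ioi 0, k s t = |s| ^ (-δ) / C := fun s hs =>
    integral_Ioi_posPart_sub_mul_rpow hs hδ
  -- Step 1: the integrand is a.e. `C ∫₀^∞ g(s) k(s, t) dt`
  have h1 : (fun s => g s * |s| ^ (-δ)) =ᵐ[volume] fun s => C * ∫ t in Ioi 0, g s * k s t := by
    filter_upwards [Measure.ae_ne volume 0] with s hs
    rw [MeasureTheory.integral_const_mul, hkint s hs]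
    field_simp
  -- Step 2: integrability on the product
  have hprod : Integrable (Function.uncurry fun s t => g s * k s t)
      ((volume : Measure ℝ).prod (volume.restrict (Ioi 0))) := by
    have hmeas : AEStronglyMeasurable (Function.uncurry fun s t => g s * k s t)
        ((volume : Measure ℝ).prod (volume.restrict (Ioi 0))) := by
      refine Measurable.aestronglyMeasurable ?_
      have hgm : Measurable g := hg.measurable
      simp only [hk, Function.uncurry_def]
      fun_prop
    rw [integrable_prod_iff hmeas]
    constructor
    · filter_upwards [Measure.ae_ne volume 0] with s hs
      exact (integrableOn_posPart_sub_mul_rpow hs hδ).const_mul (g s)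
    · have h2 : (fun s => ∫ t in Ioi 0, ‖g s * k s t‖) =ᵐ[volume]
          fun s => ‖g s * |s| ^ (-δ)‖ / C := by
        filter_upwards [Measure.ae_ne volume 0] with s hs
        have h3 : ∫ t in Ioi 0, ‖g s * k s t‖ = ∫ t in Ioi 0, ‖g s‖ * k s t := by
          refine setIntegral_congr_fun measurableSet_Ioi fun t ht => ?_
          rw [norm_mul, Real.norm_of_nonneg (hk0 s t ht)]
        rw [h3, MeasureTheory.integral_const_mul, hkint s hs, norm_mul,
          Real.norm_of_nonneg (Real.rpow_nonneg (abs_nonneg s) _)]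
        ring
      exact (hint.norm.div_const C).congr h2.symm
  -- Step 3: swap the integrals; the inner `s`-integrals are nonnegative
  rw [integral_congr_ae h1, MeasureTheory.integral_const_mul, integral_integral_swap hprod]
  refine mul_nonneg hC0.le (setIntegral_nonneg measurableSet_Ioi fun t ht => ?_)
  have h4 : ∫ s, g s * k s t = (∫ s, g s * max (t - |s|) 0) * t ^ (-(δ + 2)) := by
    rw [← MeasureTheory.integral_mul_const]
    refine integral_congr_ae (Eventually.of_forall fun s => ?_)
    simp only [hk]
    ring
  rw [h4]
  exact mul_nonneg (integral_mul_posPart_sub_abs_nonneg hg hpd ht) (Real.rpow_nonneg ht.le _)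

end Literature.Analysis.Fourier
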